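import Summits.Ventures.PercRepro.RankLevelSetPerElemFour
import Summits.Ventures.PercRepro.RankLevelSetStarPlusCircuits

/-! # RankLevelSetPerElemFiveGirth — (★★) AT LEVEL `5` AND (★★)⁺ AT LEVEL `4` ON EVERY MATROID OF GIRTH `≥ 4`
(night-1 g36; dossier §48.20; on `RankLevelSetPerElemFour` and `RankLevelSetStarPlusCircuits`)

A matroid of girth `≥ 4` (every circuit has `≥ 4` elements) has no loops and no parallel pairs, and every element
`y` is in no `cl {z}`, `z ≠ y` (**`notMem_closure_singleton_of_girth`**: a circuit inside `{y, z}` would have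
`≤ 2` elements). At level `5`, every absorbing set has a circuit of `y` with `≥ 4 = 5 − 1` elements, so the
per-circuit chain of §48.12 closes for every circuit (`perElemAt_of_coloopFree_of_circuits`); the coloops are
removed by a strong induction on `#E` (`perElem_succ_of_coloop`, the middle equality, and level `4` of
`perElemAt_four`): **`perElemAt_five_of_girth`** — `(∀ C, IsCircuit C → 4 ≤ #C) → 12 ≤ #E → #{Z ∈ D_5 : y ∉ Z} ≤
#{Q ∈ D_6 : y ∈ Q}`, and **`mono_step_five_of_girth`**. Likewise **`starPlus_four_of_girth`** on coloop-free
matroids of girth `≥ 4` (`starPlus_four_of_no_triangle`). Every declaration has a docstring; imports: the cell's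
own modules and Mathlib only. Axioms: standard. -/

namespace PercRepro

open Set Matroid

variable {α : Type} (M : Matroid α) [M.Finite]

/-! ## Girth `≥ 4` -/

omit [M.Finite] in
/-- **In a matroid of girth `≥ 4`, no element lies in the closure of another single element**: a circuit inside
`{y, z}` would have at most `2` elements. -/
lemma notMem_closure_singleton_of_girth (hg : ∀ C, M.IsCircuit C → 4 ≤ C.ncard) {y z : α} (hz : z ≠ y) :
    y ∉ M.closure {z} := by
  intro hcl
  have hyz : y ∉ ({z} : Set α) := by simpa using hz.symm
  obtain ⟨C, hCsub, hC, -⟩ := Matroid.exists_isCircuit_of_mem_closure hcl hyz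
  have h4 := hg C hC
  have : C.ncard ≤ ({y, z} : Set α).ncard :=
    Set.ncard_le_ncard (by simpa using hCsub) (Set.toFinite _)
  have h2 : ({y, z} : Set α).ncard ≤ 2 := by
    have := Set.ncard_insert_le y ({z} : Set α)
    rw [Set.ncard_singleton] at this
    exact this
  omega

omit [M.Finite] in
/-- **A matroid of girth `≥ 4` has no loops.** -/
lemma not_isLoop_of_girth (hg : ∀ C, M.IsCircuit C → 4 ≤ C.ncard) (y : α) : ¬ M.IsLoop y := by
  intro hl
  have h4 := hg {y} hl.isCircuit
  simp at h4

/-! ## Level `5` -/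

/-- **(★★) AT LEVEL `5` ON A COLOOP-FREE MATROID OF GIRTH `≥ 4`** (`11 < #E`): every circuit of `y` has `≥ 4`
elements, so every circuit class closes. -/
theorem perElemAt_five_of_coloopFree_of_girth (hcol : ∀ e, ¬ M.IsColoop e)
    (hg : ∀ C, M.IsCircuit C → 4 ≤ C.ncard) {y : α} (hy : y ∈ M.E) (hn : 2 * 5 + 1 < M.E.ncard) :
    {Z ∈ biIndep M 5 | y ∉ Z}.ncard ≤ {Q ∈ biIndep M 6 | y ∈ Q}.ncard := by
  refine perElemAt_of_coloopFree_of_circuits M hcol hy (by norm_num) hn ?_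
  intro Z₀ hZ₀
  have hycl := mem_closure_of_mem_lowAbsorbAt' M hy hZ₀
  obtain ⟨⟨-, -, hZi, -⟩, hyZ, -⟩ := hZ₀
  have hC : M.IsCircuit (M.fundCircuit y Z₀) := hZi.fundCircuit_isCircuit hycl hyZ
  have := hg _ hC
  omega

/-- **(★★) AT LEVEL `5` ON EVERY MATROID OF GIRTH `≥ 4`, by a strong induction on `#E` removing the coloops**
(the levels `4` of `M ＼ x` are `perElemAt_four`; at the middle of `M ＼ x` an equality). -/
theorem perElemAt_five_of_girth_aux :
    ∀ n : ℕ, ∀ (M' : Matroid α) [M'.Finite], M'.E.ncard = n → (∀ C, M'.IsCircuit C → 4 ≤ C.ncard) →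
      ∀ y ∈ M'.E, 2 * 5 + 1 < n → {Z ∈ biIndep M' 5 | y ∉ Z}.ncard ≤ {Q ∈ biIndep M' 6 | y ∈ Q}.ncard := by
  intro n
  induction n using Nat.strong_induction_on with
  | _ n ih =>
    intro M' _ hn hg y hy h11
    by_cases hcol : ∃ x, M'.IsColoop x
    · obtain ⟨x, hx⟩ := hcol
      haveI := delete_finite' M' x
      have hcard : (M'.delete {x}).E.ncard = n - 1 := by
        rw [Matroid.delete_ground, Set.ncard_sdiff_singleton_of_mem hx.mem_ground, hn]
      have hg' : ∀ C, (M'.delete {x}).IsCircuit C → 4 ≤ C.ncard := fun C hC => hg C hC.of_delete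
      by_cases hyx : y = x
      · subst hyx
        exact (perElem_coloop_self M' hx 5).le
      · have hyM : y ∈ (M'.delete {x}).E := by
          rw [Matroid.delete_ground]
          exact ⟨hy, by simpa using hyx⟩
        refine perElem_succ_of_coloop M' hx hyx 4 (perElemAt_four (M'.delete {x}) hyM (by omega)) ?_
        rcases Nat.lt_or_ge (2 * 5 + 1) (n - 1) with hlt | hge
        · exact ih (n - 1) (by omega) _ hcard hg' y hyM hlt
        · exact (perElem_middle_eq (M'.delete {x}) hyM 5 (by omega)).le
    simp only [not_exists] at hcol
    exact perElemAt_five_of_coloopFree_of_girth M' hcol hg hy (by omega)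

/-- **(★★) AT LEVEL `5` FOR EVERY MATROID OF GIRTH `≥ 4` AND EVERY ELEMENT** (`12 ≤ #E`):
`#{Z ∈ D_5 : y ∉ Z} ≤ #{Q ∈ D_6 : y ∈ Q}`. -/
theorem perElemAt_five_of_girth (hg : ∀ C, M.IsCircuit C → 4 ≤ C.ncard) {y : α} (hy : y ∈ M.E)
    (hn : 12 ≤ M.E.ncard) : {Z ∈ biIndep M 5 | y ∉ Z}.ncard ≤ {Q ∈ biIndep M 6 | y ∈ Q}.ncard :=
  perElemAt_five_of_girth_aux M.E.ncard M rfl hg y hy (by omega)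

/-- **MONO'S STEP `j = 5` FOR EVERY MATROID OF GIRTH `≥ 4`**: `(#E − 5) · D_5 ≤ 6 · D_6` for `12 ≤ #E`. -/
theorem mono_step_five_of_girth (hg : ∀ C, M.IsCircuit C → 4 ≤ C.ncard) (hn : 12 ≤ M.E.ncard) :
    (M.E.ncard - 5) * biIndepCount M 5 ≤ 6 * biIndepCount M 6 :=
  mono_step_of_perElemAt M 5 (fun _ hy => perElemAt_five_of_girth M hg hy hn)

/-! ## (★★)⁺ at level `4` -/

/-- **(★★)⁺ AT LEVEL `4` AT EVERY ELEMENT OF A COLOOP-FREE MATROID OF GIRTH `≥ 4`** (`8 < #E`):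
`A^y_4 ≤ A^y_{#E − 4}`. -/
theorem starPlus_four_of_girth (hcol : ∀ e, ¬ M.IsColoop e) (hg : ∀ C, M.IsCircuit C → 4 ≤ C.ncard) {y : α}
    (hy : y ∈ M.E) (hn : 8 < M.E.ncard) : lowAbsorbCount M y 4 ≤ lowAbsorbCount M y (M.E.ncard - 4) :=
  starPlus_four_of_no_triangle M hcol hy (fun _ hz => notMem_closure_singleton_of_girth M hg hz)
    (fun C hC _ => by have := hg C hC; omega) hn

end PercRepro
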